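import Summits.QuantumFields.YangMills.Theorems.IR.SCFloorTorusLateral
import Summits.QuantumFields.YangMills.Theorems.IR.BetaSlopeFloorRungStrongCoupling
import Literature.RepresentationTheory.CompactGroups.UnitaryTrick

/-!
# Strong-coupling floor engine, part 8: the facing-plaquette covariance on the torus to order `b⁴`

Pooled prover `ym-ir-line-bsf-p1` (crux `IR`, stmt-QuantumFields-19354; director-ym R366 pooled queue), support file for
`FacingPlaquetteCovFloor`.  On the 4-torus of side `L ≥ 3`, for a continuous matrix representation `ρ` of a compact
group, the Wilson-state covariance of the two FACING plaquette observables `Re tr ρ(U_{P₀})`, `Re tr ρ(U_{P₁})`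
(`P₀ = (0;1,2)`, `P₁ = (e₀;1,2)`, one lattice unit apart in time) is expanded to order `b⁴` (assembled in part 9).
This file supplies the three generic pieces and the combinatorial reduction: `cov_add_const` (centring), `doubled_symmetrise`
(symmetrisation of the doubled numerator under the copy swap), `abs_partition_sub_one_le` (`Z(b) = 1 + O(b)`), and
`mayer_sum_reduction`: in the Mayer sum over polymers `Q`, every `Q` other than the four laterals either has `≥ 5`
plaquettes or is killed by peeling (parts 4, 5), so `|∑_Q T_Q − T_{laterals}| ≤ #𝒫 · (2C_φ)² · γ⁵`.
Group-blind strong-coupling expansion on a finite torus; nothing here bears on the Yang–Mills mass gap.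
-/

set_option autoImplicit false

noncomputable section

open MeasureTheory Filter Topology Function Finset
open Literature.MathematicalPhysics.QuantumFieldTheory
open Literature.MathematicalPhysics.QuantumLattice (haarConv)

namespace Summit.QuantumFields.YangMills.Cruxes.IR.SCFloor

open BetaSlopeFloor (dTerm measurable_dTerm exists_bound_plaquetteCost measurable_inl_copy measurable_inr_copy
  covariance_wilsonMeasure_eq_doubled partition_pos integral_comp_equiv)

variable {L : ℕ} [NeZero L] [Fact (1 < L)] {G : Type*} [Group G] [TopologicalSpace G] [IsTopologicalGroup G]
  [CompactSpace G] [MeasurableSpace G] [BorelSpace G] [SecondCountableTopology G] [T2Space G]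
  {N : ℕ} (ρ : G →* Matrix (Fin N) (Fin N) ℂ)

/-! ## §1 Generic pieces: centring, symmetrisation, the partition function -/

omit [NeZero L] [Fact (1 < L)] in
/-- Centring does not change a covariance (probability measure). -/
theorem cov_add_const {Ω : Type*} [MeasurableSpace Ω] (μ : Measure Ω) [IsProbabilityMeasure μ] {f g : Ω → ℝ}
    (hf : Integrable f μ) (hg : Integrable g μ) (hfg : Integrable (fun ω => f ω * g ω) μ) (a c : ℝ) :
    (∫ ω, (f ω + a) * (g ω + c) ∂μ) - (∫ ω, (f ω + a) ∂μ) * (∫ ω, (g ω + c) ∂μ) =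
      (∫ ω, f ω * g ω ∂μ) - (∫ ω, f ω ∂μ) * ∫ ω, g ω ∂μ := by
  have h : ∀ ω, (f ω + a) * (g ω + c) = f ω * g ω + c * f ω + a * g ω + a * c := fun ω => by ring
  simp_rw [h]
  have i1 : Integrable (fun ω => f ω * g ω + c * f ω) μ := hfg.add (hf.const_mul c)
  have i2 : Integrable (fun ω => f ω * g ω + c * f ω + a * g ω) μ := i1.add (hg.const_mul a)
  rw [integral_add i2 (integrable_const _), integral_add i1 (hg.const_mul a), integral_add hfg (hf.const_mul c),
    integral_const_mul, integral_const_mul, integral_add hf (integrable_const _),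
    integral_add hg (integrable_const _)]
  simp only [integral_const, probReal_univ, smul_eq_mul, one_mul]
  ring

omit [Fact (1 < L)] [SecondCountableTopology G] [T2Space G] in
/-- **Symmetrisation of the doubled covariance numerator**: for a swap-symmetric weight `E`,
`∫ A₀(U)(A₁(U) − A₁(U')) E = ½ ∫ (A₀(U) − A₀(U'))(A₁(U) − A₁(U')) E`. -/
theorem doubled_symmetrise {A₀ A₁ : GaugeConfig 4 L G → ℝ} (hA₀ : Measurable A₀) (hA₁ : Measurable A₁) {C : ℝ}
    (hA₀b : ∀ U, |A₀ U| ≤ C) (hA₁b : ∀ U, |A₁ U| ≤ C) {E : (Edge 4 L ⊕ Edge 4 L → G) → ℝ} (hEm : Measurable E)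
    {CE : ℝ} (hEb : ∀ W, |E W| ≤ CE) (hEs : ∀ W, E (fun i => W (Sum.swap i)) = E W) :
    ∫ W, A₀ (fun e => W (Sum.inl e)) * (A₁ (fun e => W (Sum.inl e)) - A₁ (fun e => W (Sum.inr e))) * E W
        ∂(Measure.pi fun _ : Edge 4 L ⊕ Edge 4 L => haarProbability G) =
      (1 / 2) * ∫ W, (A₀ (fun e => W (Sum.inl e)) - A₀ (fun e => W (Sum.inr e))) *
        (A₁ (fun e => W (Sum.inl e)) - A₁ (fun e => W (Sum.inr e))) * E W
        ∂(Measure.pi fun _ : Edge 4 L ⊕ Edge 4 L => haarProbability G) := by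
  have hC : 0 ≤ C := (abs_nonneg _).trans (hA₀b fun _ => 1)
  have hd : ∀ U U', |A₁ U - A₁ U'| ≤ 2 * C := fun U U' => (abs_sub _ _).trans (by linarith [hA₁b U, hA₁b U'])
  have hmeas : Measurable fun W : Edge 4 L ⊕ Edge 4 L → G =>
      A₀ (fun e => W (Sum.inr e)) * (A₁ (fun e => W (Sum.inr e)) - A₁ (fun e => W (Sum.inl e))) * E W :=
    ((hA₀.comp measurable_inr_copy).mul ((hA₁.comp measurable_inr_copy).sub (hA₁.comp measurable_inl_copy))).mul hEm
  have hsw := integral_comp_equiv (haarProbability G) (Equiv.sumComm (Edge 4 L) (Edge 4 L)) hmeas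
  simp only [Equiv.sumComm_apply, Sum.swap_inl, Sum.swap_inr] at hsw
  simp_rw [hEs] at hsw
  have hI1 : Integrable (fun W => A₀ (fun e => W (Sum.inl e)) *
      (A₁ (fun e => W (Sum.inl e)) - A₁ (fun e => W (Sum.inr e))) * E W)
      (Measure.pi fun _ : Edge 4 L ⊕ Edge 4 L => haarProbability G) :=
    Integrable.of_bound (((hA₀.comp measurable_inl_copy).mul ((hA₁.comp measurable_inl_copy).sub
      (hA₁.comp measurable_inr_copy))).mul hEm).aestronglyMeasurable (C * (2 * C) * CE)
      (Eventually.of_forall fun W => by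
        rw [Real.norm_eq_abs, abs_mul, abs_mul]
        exact mul_le_mul (mul_le_mul (hA₀b _) (hd _ _) (abs_nonneg _) hC) (hEb W) (abs_nonneg _) (by positivity))
  have hI2 : Integrable (fun W => A₀ (fun e => W (Sum.inr e)) *
      (A₁ (fun e => W (Sum.inr e)) - A₁ (fun e => W (Sum.inl e))) * E W)
      (Measure.pi fun _ : Edge 4 L ⊕ Edge 4 L => haarProbability G) :=
    Integrable.of_bound hmeas.aestronglyMeasurable (C * (2 * C) * CE) (Eventually.of_forall fun W => by
      rw [Real.norm_eq_abs, abs_mul, abs_mul]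
      exact mul_le_mul (mul_le_mul (hA₀b _) (hd _ _) (abs_nonneg _) hC) (hEb W) (abs_nonneg _) (by positivity))
  have hsplit : ∀ W : Edge 4 L ⊕ Edge 4 L → G, (A₀ (fun e => W (Sum.inl e)) - A₀ (fun e => W (Sum.inr e))) *
      (A₁ (fun e => W (Sum.inl e)) - A₁ (fun e => W (Sum.inr e))) * E W =
      A₀ (fun e => W (Sum.inl e)) * (A₁ (fun e => W (Sum.inl e)) - A₁ (fun e => W (Sum.inr e))) * E W +
        A₀ (fun e => W (Sum.inr e)) * (A₁ (fun e => W (Sum.inr e)) - A₁ (fun e => W (Sum.inl e))) * E W :=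
    fun W => by ring
  simp_rw [hsplit]
  rw [integral_add hI1 hI2, ← hsw]
  ring

omit [Fact (1 < L)] [T2Space G] in
/-- **The partition function is close to `1`**: `|∫ e^{−bS} dπ − 1| ≤ |b| S_max e^{|b| S_max}`. -/
theorem abs_partition_sub_one_le (hρ : Continuous ρ) {Smax : ℝ} (hS : ∀ U : GaugeConfig 4 L G, |wilsonAction ρ U| ≤ Smax)
    (b : ℝ) :
    |(∫ U, (1 : ℝ) * Real.exp (b * -wilsonAction ρ U) ∂(Measure.pi fun _ : Edge 4 L => haarProbability G)) - 1| ≤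
      |b| * Smax * Real.exp (|b| * Smax) := by
  set π : Measure (GaugeConfig 4 L G) := Measure.pi fun _ : Edge 4 L => haarProbability G with hπ
  haveI : IsProbabilityMeasure π := by rw [hπ]; infer_instance
  have hS0 : 0 ≤ Smax := (abs_nonneg _).trans (hS fun _ => 1)
  have hx : ∀ U, |b * -wilsonAction ρ U| ≤ |b| * Smax := fun U => by
    rw [abs_mul, abs_neg]; exact mul_le_mul_of_nonneg_left (hS U) (abs_nonneg b)
  have hm : Measurable fun U : GaugeConfig 4 L G => Real.exp (b * -wilsonAction ρ U) - 1 :=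
    (((measurable_wilsonAction ρ hρ).neg.const_mul b).exp).sub measurable_const
  have hI : Integrable (fun U => Real.exp (b * -wilsonAction ρ U) - 1) π :=
    Integrable.of_bound hm.aestronglyMeasurable (|b| * Smax * Real.exp (|b| * Smax))
      (Eventually.of_forall fun U => by
        rw [Real.norm_eq_abs]
        exact (Literature.NumberTheory.Sieve.BombieriSieve.abs_exp_sub_one_le _).trans
          (mul_le_mul (hx U) (Real.exp_le_exp.2 (hx U)) (Real.exp_pos _).le (by positivity)))
  have heq : (∫ U, (1 : ℝ) * Real.exp (b * -wilsonAction ρ U) ∂π) - 1 =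
      ∫ U, (Real.exp (b * -wilsonAction ρ U) - 1) ∂π := by
    rw [integral_sub (hI.add (integrable_const 1) |>.congr (Eventually.of_forall fun U => by simp)) (integrable_const _)]
    simp
  rw [heq]
  refine (abs_integral_le_integral_abs).trans ?_
  calc ∫ U, |Real.exp (b * -wilsonAction ρ U) - 1| ∂π ≤ ∫ _U, |b| * Smax * Real.exp (|b| * Smax) ∂π :=
        integral_mono_of_nonneg (Eventually.of_forall fun _ => abs_nonneg _) (integrable_const _)
          (Eventually.of_forall fun U => (Literature.NumberTheory.Sieve.BombieriSieve.abs_exp_sub_one_le _).trans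
            (mul_le_mul (hx U) (Real.exp_le_exp.2 (hx U)) (Real.exp_pos _).le (by positivity)))
    _ = |b| * Smax * Real.exp (|b| * Smax) := by simp

/-! ## §2 The Mayer sum: only the lateral polymer and long polymers contribute -/

/-- **Reduction of the Mayer sum.**  With `ΔΔ = Δφ(hol_{P₀}) Δφ(hol_{P₁})` and `γ = 2B|b|e^{2B|b|} ≤ 1`:
`|∑_{Q} ∫ ΔΔ ∏_{q∈Q} g_q − ∫ ΔΔ ∏ₖ g_{ℓₖ}| ≤ #𝒫(plaquettes) · (2C_φ)² · γ⁵` — every polymer other than the four laterals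
either has at least five plaquettes or is killed by peeling (parts 4, 5). -/
theorem mayer_sum_reduction (hρ : Continuous ρ) (hL : 3 ≤ L) {φ : G → ℝ} (hφc : Continuous φ) {Cφ : ℝ}
    (hCφ : ∀ g, |φ g| ≤ Cφ) {B : ℝ} (hB : ∀ (U : GaugeConfig 4 L G) (p : Plaquette 4 L), |plaquetteCost ρ U p| ≤ B)
    (b : ℝ) (hγ : 2 * B * |b| * Real.exp (2 * B * |b|) ≤ 1) :
    |(∑ Q ∈ (Finset.univ : Finset (Plaquette 4 L)).powerset,
        ∫ W, (φ (plaquetteHolonomy (fun a => W (Sum.inl a)) 0 1 2) - φ (plaquetteHolonomy (fun a => W (Sum.inr a)) 0 1 2)) *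
          (φ (plaquetteHolonomy (fun a => W (Sum.inl a)) ((0 : Site 4 L).shift 0) 1 2) -
            φ (plaquetteHolonomy (fun a => W (Sum.inr a)) ((0 : Site 4 L).shift 0) 1 2)) *
          ∏ q ∈ Q, (Real.exp (-(b * dTerm ρ q W)) - 1) ∂(Measure.pi fun _ : Edge 4 L ⊕ Edge 4 L => haarProbability G)) -
      ∫ W, (φ (plaquetteHolonomy (fun a => W (Sum.inl a)) 0 1 2) - φ (plaquetteHolonomy (fun a => W (Sum.inr a)) 0 1 2)) *
          (φ (plaquetteHolonomy (fun a => W (Sum.inl a)) ((0 : Site 4 L).shift 0) 1 2) -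
            φ (plaquetteHolonomy (fun a => W (Sum.inr a)) ((0 : Site 4 L).shift 0) 1 2)) *
          ∏ k : Fin 4, (Real.exp (-(b * dTerm ρ ((![((0 : Site 4 L), ⟨((0 : Fin 4), (1 : Fin 4)), by decide⟩), ((0 : Site 4 L).shift 2, ⟨((0 : Fin 4), (1 : Fin 4)), by decide⟩),
        ((0 : Site 4 L), ⟨((0 : Fin 4), (2 : Fin 4)), by decide⟩), ((0 : Site 4 L).shift 1, ⟨((0 : Fin 4), (2 : Fin 4)), by decide⟩)] :
        Fin 4 → Plaquette 4 L) k) W)) - 1)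
        ∂(Measure.pi fun _ : Edge 4 L ⊕ Edge 4 L => haarProbability G)| ≤
      ((Finset.univ : Finset (Plaquette 4 L)).powerset.card : ℝ) * ((2 * Cφ) * (2 * Cφ)) *
        (2 * B * |b| * Real.exp (2 * B * |b|)) ^ 5 := by
  classical
  set μ₂ : Measure (Edge 4 L ⊕ Edge 4 L → G) := Measure.pi fun _ => haarProbability G with hμ₂
  set s0 : Site 4 L := (0 : Site 4 L).shift 0 with hs0
  set Lat : Finset (Plaquette 4 L) := ({((0 : Site 4 L), ⟨((0 : Fin 4), (1 : Fin 4)), by decide⟩),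
      ((0 : Site 4 L).shift 2, ⟨((0 : Fin 4), (1 : Fin 4)), by decide⟩),
      ((0 : Site 4 L), ⟨((0 : Fin 4), (2 : Fin 4)), by decide⟩),
      ((0 : Site 4 L).shift 1, ⟨((0 : Fin 4), (2 : Fin 4)), by decide⟩)} : Finset (Plaquette 4 L)) with hLat
  set γ : ℝ := 2 * B * |b| * Real.exp (2 * B * |b|) with hγdef
  have hγ0 : 0 ≤ γ := by
    have : 0 ≤ B := (abs_nonneg _).trans (hB (fun _ => 1) ((0 : Site 4 L), ⟨((0 : Fin 4), (1 : Fin 4)), by decide⟩))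
    positivity
  set ΔΔ : (Edge 4 L ⊕ Edge 4 L → G) → ℝ := fun W =>
    (φ (plaquetteHolonomy (fun a => W (Sum.inl a)) 0 1 2) - φ (plaquetteHolonomy (fun a => W (Sum.inr a)) 0 1 2)) *
      (φ (plaquetteHolonomy (fun a => W (Sum.inl a)) s0 1 2) - φ (plaquetteHolonomy (fun a => W (Sum.inr a)) s0 1 2))
    with hΔΔ
  set T : Finset (Plaquette 4 L) → ℝ := fun Q => ∫ W, ΔΔ W * ∏ q ∈ Q, (Real.exp (-(b * dTerm ρ q W)) - 1) ∂μ₂ with hT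
  have hC0 : 0 ≤ Cφ := (abs_nonneg _).trans (hCφ 1)
  have hd : ∀ h h' : G, |φ h - φ h'| ≤ 2 * Cφ := fun h h' => (abs_sub _ _).trans (by linarith [hCφ h, hCφ h'])
  have hΔΔb : ∀ W, |ΔΔ W| ≤ (2 * Cφ) * (2 * Cφ) := fun W => by
    simp only [hΔΔ, abs_mul]; exact mul_le_mul (hd _ _) (hd _ _) (abs_nonneg _) (by positivity)
  -- every term is `O(γ^{|Q|})`
  have hTb : ∀ Q, |T Q| ≤ (2 * Cφ) * (2 * Cφ) * γ ^ Q.card := fun Q => abs_mayer_term_le ρ hB b Q hΔΔb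
  -- short polymers other than the laterals are killed by peeling
  have hP01 : ∀ {e : Edge 4 L}, e ∈ ({((0 : Site 4 L), (1 : Fin 4)), ((0 : Site 4 L).shift 1, (2 : Fin 4)),
        ((0 : Site 4 L).shift 2, (1 : Fin 4)), ((0 : Site 4 L), (2 : Fin 4))} : Finset (Edge 4 L)) → e ∉ ({(((0 : Site 4 L).shift 0), (1 : Fin 4)), (((0 : Site 4 L).shift 0).shift 1, (2 : Fin 4)),
        (((0 : Site 4 L).shift 0).shift 2, (1 : Fin 4)), (((0 : Site 4 L).shift 0), (2 : Fin 4))} : Finset (Edge 4 L)) := by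
    intro e he he'
    have h0 := (bondP_cases (0 : Site 4 L) he).1
    have h1' := (bondP_cases ((0 : Site 4 L).shift 0) he').1
    rw [h0] at h1'
    simp at h1'
  have hvan : ∀ Q, Q ≠ Lat → Q.card ≤ 4 → T Q = 0 := by
    intro Q hQ hcard
    by_cases h0 : ∀ e ∈ ({((0 : Site 4 L), (1 : Fin 4)), ((0 : Site 4 L).shift 1, (2 : Fin 4)),
        ((0 : Site 4 L).shift 2, (1 : Fin 4)), ((0 : Site 4 L), (2 : Fin 4))} : Finset (Edge 4 L)), ∃ q ∈ Q, q ≠ ((0 : Site 4 L), ⟨((1 : Fin 4), (2 : Fin 4)), by decide⟩) ∧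
        e ∈ ({(q.1, q.2.1.1), (q.1.shift q.2.1.1, q.2.1.2), (q.1.shift q.2.1.2, q.2.1.1), (q.1, q.2.1.2)} :
          Finset (Edge 4 L))
    · by_cases h1 : ∀ e ∈ ({(((0 : Site 4 L).shift 0), (1 : Fin 4)), (((0 : Site 4 L).shift 0).shift 1, (2 : Fin 4)),
        (((0 : Site 4 L).shift 0).shift 2, (1 : Fin 4)), (((0 : Site 4 L).shift 0), (2 : Fin 4))} : Finset (Edge 4 L)), ∃ q ∈ Q, q ≠ (((0 : Site 4 L).shift 0), ⟨((1 : Fin 4), (2 : Fin 4)), by decide⟩) ∧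
          e ∈ ({(q.1, q.2.1.1), (q.1.shift q.2.1.1, q.2.1.2), (q.1.shift q.2.1.2, q.2.1.1), (q.1, q.2.1.2)} :
            Finset (Edge 4 L))
      · exact absurd (eq_laterals_of_covering hL hcard h0 h1) hQ
      · push Not at h1
        obtain ⟨e, he, hQe⟩ := h1
        have he' : e ∉ ({((0 : Site 4 L), (1 : Fin 4)), ((0 : Site 4 L).shift 1, (2 : Fin 4)),
        ((0 : Site 4 L).shift 2, (1 : Fin 4)), ((0 : Site 4 L), (2 : Fin 4))} : Finset (Edge 4 L)) := fun h => hP01 h he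
        have h := mayer_term_eq_zero ρ hρ hφc ((0 : Site 4 L).shift 0) 0 b Q he he' hQe
        simp only [hT, hΔΔ]
        rw [← h]
        exact integral_congr_ae (Eventually.of_forall fun W => by ring)
    · push Not at h0
      obtain ⟨e, he, hQe⟩ := h0
      exact mayer_term_eq_zero ρ hρ hφc 0 ((0 : Site 4 L).shift 0) b Q he (hP01 he) hQe
  -- the lateral term as a product over `Fin 4`
  have h1 : (1 : ZMod L) ≠ 0 := one_ne_zero
  have hs0ne : ∀ k : Fin 4, (0 : Site 4 L) ≠ (0 : Site 4 L).shift k := fun k h => by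
    have := congrFun h k; simp at this
  have hTLat : T Lat = ∫ W, ΔΔ W * ∏ k : Fin 4, (Real.exp (-(b * dTerm ρ ((![((0 : Site 4 L), ⟨((0 : Fin 4), (1 : Fin 4)), by decide⟩), ((0 : Site 4 L).shift 2, ⟨((0 : Fin 4), (1 : Fin 4)), by decide⟩),
        ((0 : Site 4 L), ⟨((0 : Fin 4), (2 : Fin 4)), by decide⟩), ((0 : Site 4 L).shift 1, ⟨((0 : Fin 4), (2 : Fin 4)), by decide⟩)] :
        Fin 4 → Plaquette 4 L) k) W)) - 1) ∂μ₂ := by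
    simp only [hT]
    refine integral_congr_ae (Eventually.of_forall fun W => ?_)
    simp only [hLat]
    rw [Finset.prod_insert, Finset.prod_insert, Finset.prod_pair, Fin.prod_univ_four]
    · simp only [Matrix.cons_val_zero, Matrix.cons_val_one, Matrix.cons_val]; ring
    · intro h; have := (Prod.ext_iff.1 h).1; exact hs0ne 1 this
    · simp only [Finset.mem_insert, Finset.mem_singleton, Prod.mk.injEq, not_or]
      refine ⟨fun h => absurd h.2 (by decide), fun h => absurd h.2 (by decide)⟩
    · simp only [Finset.mem_insert, Finset.mem_singleton, Prod.mk.injEq, not_or]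
      refine ⟨fun h => hs0ne 2 h.1, fun h => absurd h.2 (by decide), fun h => absurd h.2 (by decide)⟩
  -- split off the lateral term
  have hmem : Lat ∈ (Finset.univ : Finset (Plaquette 4 L)).powerset := Finset.mem_powerset.2 (Finset.subset_univ _)
  change |(∑ Q ∈ (Finset.univ : Finset (Plaquette 4 L)).powerset, T Q) -
      ∫ W, ΔΔ W * ∏ k : Fin 4, (Real.exp (-(b * dTerm ρ ((![((0 : Site 4 L), ⟨((0 : Fin 4), (1 : Fin 4)), by decide⟩), ((0 : Site 4 L).shift 2, ⟨((0 : Fin 4), (1 : Fin 4)), by decide⟩),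
        ((0 : Site 4 L), ⟨((0 : Fin 4), (2 : Fin 4)), by decide⟩), ((0 : Site 4 L).shift 1, ⟨((0 : Fin 4), (2 : Fin 4)), by decide⟩)] :
        Fin 4 → Plaquette 4 L) k) W)) - 1) ∂μ₂| ≤ _
  rw [← hTLat, ← Finset.add_sum_erase _ _ hmem, add_sub_cancel_left]
  refine (Finset.abs_sum_le_sum_abs _ _).trans ?_
  have hterm : ∀ Q ∈ (Finset.univ : Finset (Plaquette 4 L)).powerset.erase Lat,
      |T Q| ≤ (2 * Cφ) * (2 * Cφ) * γ ^ 5 := by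
    intro Q hQ
    have hQne : Q ≠ Lat := Finset.ne_of_mem_erase hQ
    by_cases hc : Q.card ≤ 4
    · rw [hvan Q hQne hc, abs_zero]; positivity
    · push Not at hc
      exact (hTb Q).trans (mul_le_mul_of_nonneg_left (pow_le_pow_of_le_one hγ0 hγ hc) (by positivity))
  calc ∑ Q ∈ (Finset.univ : Finset (Plaquette 4 L)).powerset.erase Lat, |T Q|
      ≤ ∑ _Q ∈ (Finset.univ : Finset (Plaquette 4 L)).powerset.erase Lat, (2 * Cφ) * (2 * Cφ) * γ ^ 5 :=
        Finset.sum_le_sum hterm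
    _ = (((Finset.univ : Finset (Plaquette 4 L)).powerset.erase Lat).card : ℝ) * ((2 * Cφ) * (2 * Cφ) * γ ^ 5) := by
        rw [Finset.sum_const, nsmul_eq_mul]
    _ ≤ ((Finset.univ : Finset (Plaquette 4 L)).powerset.card : ℝ) * ((2 * Cφ) * (2 * Cφ) * γ ^ 5) :=
        mul_le_mul_of_nonneg_right (by exact_mod_cast Finset.card_erase_le) (by positivity)
    _ = _ := by ring

end Summit.QuantumFields.YangMills.Cruxes.IR.SCFloor

end
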